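import Summits.QuantumFields.YangMills.Theorems.BalabanUVNodesPortS1LZHalfRegT8
import Summits.QuantumFields.YangMills.Theorems.BalabanUVNodesPortS1FEInductionByName
import Summits.QuantumFields.YangMills.Theorems.BalabanUVNodesPortS1FEStepConverse
import Summits.QuantumFields.YangMills.Theorems.BalabanUVNodesPortS1FEStepReg
import Summits.QuantumFields.YangMills.Theorems.BalabanUVNodesPortRecordRepresentationS1StubG3C

/-!
# NODE O port PT-A — THE CLOSING FRAME OF RECORD OF ⟨27930⟩ AFTER gen 11 (★★★ director-ym №637 (1)(d) ∕ №641 (1)(b) ∕ №643 (1); line `pta_residueW`, registry v3.8): the crux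
# `PortRecordRepresentationS1` BY NAME from the SEVEN displayed letters on ONE P0 wall + the FE step — `P0HolExtAtRecordGL` (= `stub_P0C`), `ClassP2Reg`, `RegClassP5`, `RegClassNestsUc`
# (= `stub_regClassNestsUc`, shared with FE), `FEChartLawReg` (S₁), `FEPolymerActivitiesReg` (S₃), `FEPolymerResummation` (S₄)

Cell `ym-nodeO-ideate`, porter seat PT-A-1 (gen 11); `--kind proof --supports stmt-QuantumFields-27930 --as helper`; count-neutral.  [I] = [Balaban1987RG1]; [II] = [Balaban1988RG2Cluster].

WHY.  v3.8's composition is `PortRecordRepresentationS1_of stub_P0C stub_G3C stub_LZhalfReg stub_FEchartLawReg stub_regClassNestsUc stub_FEpolymerActivitiesReg stub_FEpolymerResummation`.  With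
✓`stub_G3C` (p824985), the (α) brick ✓`lzHalfReg_of_P0C_of_classP2_of_regClass` (`stub_LZhalfReg`'s type from `P0HolExtAtRecordGL`, `ClassP2Reg`, `RegClassP5`, `RegClassNestsUc`) and ★★ DEF-1's
✓`feStepReg_of_polymerPieces` (`FEStepReg` from `P0HolExtAtRecordGL` + S₁ + S₂ + S₃ + S₄), the crux is a THEOREM MODULO EXACTLY the seven letters of the title; this file records that composition
in the kernel (✓`PortRecordRepresentationS1_of_step` fed from the ε₀-class pair by ✓`portRecordFEHalfBox_of_reg` → ✓`feStepBox_of_feHalfBox`, as the skeleton does).  It states the cost of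
⟨27930⟩ at its true price: the registry asks to DISPLAY [15] Thm 1's regularity (`RegClassNestsUc`) and the (2.11) positivity on the class (`RegClassP5`), not to prove them antecedent-free (the
antecedent-free frames ✓`portRecordRepresentationS1_of_letters[L]` stay as the STRONGER conditionals — history).
* ★★★ `portRecordRepresentationS1_of_regLetters`.

HONEST FRAMING.  CONDITIONAL bookkeeping: the seven letters are inhabited NOWHERE (`P0HolExtAtRecordGL` = node00-def-Y's M2-ℂ scheme; `ClassP2Reg`∕`RegClassP5` = its class by-products;
`RegClassNestsUc` = [15] Thm 1 regularity displayed; S₁ XL, S₃ XXL (the wall), S₄ M–L in ★★ DEF-1's hands); no registry act by this file; nothing of Bałaban's RG estimates asserted, ported or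
discharged; ⟨27930⟩ OPEN (1∕7 under v3.8) · no claim; NODE O 0∕1; COUNT 8∕28 · K 1∕4 UNMOVED; finite `𝕋⁴_{L^K}` at fixed ε — NOT continuum ∕ OS; **the Yang–Mills mass gap (Clay) is NOT proved by any
of this.**  No `sorry`, no `def`; standard axioms.
-/

noncomputable section

namespace Summit.QuantumFields.YangMills.Theorems.BalabanUVNodesPortS1

open Summit.QuantumFields.YangMills.Theorems.K0RecordFormatNames
open Literature.MathematicalPhysics.QuantumFieldTheory.Balaban1983to89.T4Continuum (T4Family)

/-- ★★★ **⟨27930⟩ BY NAME FROM THE SEVEN LETTERS** `P0HolExtAtRecordGL`, `ClassP2Reg`, `RegClassP5`, `RegClassNestsUc`, `FEChartLawReg`, `FEPolymerActivitiesReg`, `FEPolymerResummation`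
(each for every torus family): the route declaration `Summit.QuantumFields.YangMills.Theses.BalabanUVNodes.PortRecordRepresentationS1` — v3.8's composition with `stub_G3C` ✓ landed, the
LZ half by ✓`lzHalfReg_of_P0C_of_classP2_of_regClass`, the FE step by ✓`feStepReg_of_polymerPieces`.  CONDITIONAL; asserted for nothing beyond its hypotheses.
[cite: Balaban1987RG1, Theorem 3 p.264, (1.6)–(1.21) pp.261–264, (2.1)–(2.14) pp.265–268, p.263 L5–13; Balaban1988RG2Cluster, (2.11)–(2.13) p.14, Lemma 3 p.21] -/
theorem portRecordRepresentationS1_of_regLetters (hP0C : ∀ F, P0HolExtAtRecordGL F) (hC2 : ∀ F, ClassP2Reg F) (hC5 : ∀ F, RegClassP5 F) (hN : ∀ F, RegClassNestsUc F)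
    (hS₁ : ∀ F, FEChartLawReg F) (hS₃ : ∀ F, FEPolymerActivitiesReg F) (hS₄ : ∀ F, FEPolymerResummation F) :
    Summit.QuantumFields.YangMills.Theses.BalabanUVNodes.PortRecordRepresentationS1 :=
  PortRecordRepresentationS1_of_step hP0C stub_G3C
    (fun F => feStepBox_of_feHalfBox (portRecordFEHalfBox_of_reg (lzHalfReg_of_P0C_of_classP2_of_regClass hP0C hC2 hC5 hN)
      (feStepReg_of_polymerPieces hP0C hS₁ hN hS₃ hS₄) F))

end Summit.QuantumFields.YangMills.Theorems.BalabanUVNodesPortS1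

end
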